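import Summits.RiemannHypothesis.RiemannHypothesis.Theorems.PfPersistenceM2EvenSectorLevelZero
import HarnessLib

/-!
# Even sector of the Pf-persistence index route (M2): the linear zero budget of a test function

Long-odds MECHANISM SEARCH (cell `pub-rhpf`, seat M2); every result here is RH-free and makes
no claim about RH.

Quantitative form of the level-zero no-go of `PfPersistenceM2EvenSectorLevelZero`.  For a Weil
test function `φ` (smooth, compact support in `[-b, b]`) with `φ̂(c) ≠ 0`:

* `finsetCard_zeros_le_linear` — FACT-FREE zero budget: any finite set of DISTINCT zeros of `φ̂`
  in the disc `‖u‖ ≤ T + 1` (`T ≥ 1`) has at most `e·b·T + B(φ, c)` elements, with the explicit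
  constant `B(φ, c) = b (e (‖c‖ + 1) + ‖c‖ + 1) + log (max (∫‖φ‖) 1) - log ‖φ̂(c)‖` — the slope is
  `e` times the support radius.  (Jensen, `finsetCard_zeros_le_jensen`, on `|s - c| ≤ e (T + ‖c‖ + 1)`
  with the exponential-type bound `norm_weilMellin_le_exp_mul_integral_norm` of the tree.)
* `exists_linear_zero_budget` — the same with `∃ A B`, for any `φ` with `φ̂ ≢ 0`.
* `ncard_vanishing_simpleCritical_le_linear` — in particular `φ̂` vanishes at no more than
  `A T + B` of the simple critical zeros `1/2 + iγ`, `0 < γ ≤ T`.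
* `tendsto_vanishing_simpleCritical_ratio` — under the named facts `riemann_von_mangoldt` and
  `Anderson1983_levinson_simple` (which make the simple critical zeros `≥ N(T)/3 ≫ T log T`), the
  PROPORTION of simple critical zeros up to height `T` killed by `φ̂` tends to `0`: a non-zero
  test function "sees" asymptotically all simple critical zeros.  The qualitative corollary
  (`φ̂` cannot vanish at all of them) is `weilMellin_eq_zero_of_vanish_simpleCritical`.
-/

open Complex Filter Set MeasureTheory Metric
open scoped Real Topology

namespace Summit.RiemannHypothesis.RiemannHypothesis.Theorems.PfPersistenceM2NegIndex

open Literature.NumberTheory.LFunctions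
open Literature.NumberTheory.LFunctions.ZetaZeros

/-! ## The fact-free linear zero budget -/

/-- **Linear zero budget, explicit form (fact-free).** Let `φ` be a Weil test function with
`tsupport φ ⊆ [-b, b]` (`b ≥ 0`) and `φ̂(c) ≠ 0`.  For `T ≥ 1`, every finite set of distinct zeros
of `φ̂` inside `‖u‖ ≤ T + 1` has at most
`e b T + (b (e (‖c‖ + 1) + ‖c‖ + 1) + log (max (∫‖φ‖) 1) - log ‖φ̂ c‖)` elements. [folklore] -/
theorem finsetCard_zeros_le_linear {φ : ℝ → ℂ} (hφ : IsWeilTest φ) {b : ℝ} (hb0 : 0 ≤ b)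
    (hsupp : tsupport φ ⊆ Icc (-b) b) {c : ℂ} (hc : weilMellin φ c ≠ 0) {T : ℝ} (hT : 1 ≤ T)
    (Z : Finset ℂ) (hZ : ∀ u ∈ Z, ‖u‖ ≤ T + 1 ∧ weilMellin φ u = 0) :
    (Z.card : ℝ) ≤ Real.exp 1 * b * T + (b * (Real.exp 1 * (‖c‖ + 1) + ‖c‖ + 1) +
      Real.log (max (∫ t, ‖φ t‖) 1) - Real.log ‖weilMellin φ c‖) := by
  set F := weilMellin φ with hF
  set L := ∫ t, ‖φ t‖ with hL
  have hL0 : 0 ≤ L := integral_nonneg fun _ ↦ norm_nonneg _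
  have hFan : AnalyticOnNhd ℂ F univ := analyticOnNhd_weilMellin hφ.1.continuous hφ.2 univ
  set r := T + ‖c‖ + 1 with hr
  have hr0 : 0 < r := by positivity
  set R := Real.exp 1 * r with hRdef
  have he : 1 < Real.exp 1 := Real.one_lt_exp_iff.2 one_pos
  have hrR : r < R := by rw [hRdef]; exact lt_mul_left hr0 he
  set κ := b * (R + ‖c‖ + 1) with hκ
  have hκ0 : 0 ≤ κ := by positivity
  set M := Real.exp κ * max L 1 with hMdef
  have hM1 : 1 ≤ M := by
    rw [hMdef]
    nlinarith [Real.one_le_exp_iff.2 hκ0, le_max_right L 1, (Real.exp_pos κ).le]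
  -- the bound on the circle `|z - c| = R`
  have hFM : ∀ z ∈ sphere c R, ‖F z‖ ≤ M := by
    intro z hz
    rw [mem_sphere, dist_eq_norm] at hz
    have h1 := norm_weilMellin_le_exp_mul_integral_norm hφ.1.continuous hφ.2 hsupp z
    have hzre : |z.re - 1 / 2| ≤ R + ‖c‖ + 1 := by
      have e1 : |z.re - c.re| ≤ ‖z - c‖ := by
        rw [← sub_re]
        exact abs_re_le_norm (z - c)
      have e2 : |c.re| ≤ ‖c‖ := abs_re_le_norm c
      have t1 : |z.re - 1 / 2| ≤ |z.re - c.re| + |c.re - 1 / 2| := abs_sub_le _ _ _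
      have t2 : |c.re - 1 / 2| ≤ |c.re| + |(1 / 2 : ℝ)| := abs_sub _ _
      have t3 : |(1 / 2 : ℝ)| = 1 / 2 := by norm_num
      linarith
    calc ‖F z‖ ≤ Real.exp (b * |z.re - 1 / 2|) * L := h1
      _ ≤ Real.exp κ * L := by
          gcongr
          calc b * |z.re - 1 / 2| ≤ b * (R + ‖c‖ + 1) := mul_le_mul_of_nonneg_left hzre hb0
            _ = κ := by rw [hκ]
      _ ≤ M := by rw [hMdef]; gcongr; exact le_max_left _ _
  have hZ' : ∀ u ∈ Z, u ∈ closedBall c r ∧ F u = 0 := by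
    intro u hu
    obtain ⟨hu1, hu0⟩ := hZ u hu
    refine ⟨?_, hu0⟩
    rw [mem_closedBall, dist_eq_norm]
    calc ‖u - c‖ ≤ ‖u‖ + ‖c‖ := norm_sub_le _ _
      _ ≤ r := by rw [hr]; linarith
  have hcard := finsetCard_zeros_le_jensen hr0 hrR hM1 (hFan.mono (subset_univ _)) hFM hc Z hZ'
  have hRr : R / r = Real.exp 1 := by rw [hRdef]; field_simp
  rw [hRr, Real.log_exp, div_one, Real.log_div (by positivity) (norm_ne_zero_iff.2 hc),
    hMdef, Real.log_mul (Real.exp_pos κ).ne' (by positivity), Real.log_exp] at hcard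
  calc (Z.card : ℝ) ≤ κ + Real.log (max L 1) - Real.log ‖F c‖ := hcard
    _ = _ := by rw [hκ, hRdef, hr]; ring

/-- **Linear zero budget (fact-free).** If `φ` is a Weil test function with `φ̂ ≢ 0`, there are
constants `A ≥ 0` and `B` such that for every `T ≥ 1` any finite set of distinct zeros of `φ̂` in
`‖u‖ ≤ T + 1` has at most `A T + B` elements. [folklore] -/
theorem exists_linear_zero_budget {φ : ℝ → ℂ} (hφ : IsWeilTest φ) (hne : weilMellin φ ≠ 0) :
    ∃ A B : ℝ, 0 ≤ A ∧ ∀ T : ℝ, 1 ≤ T → ∀ Z : Finset ℂ,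
      (∀ u ∈ Z, ‖u‖ ≤ T + 1 ∧ weilMellin φ u = 0) → (Z.card : ℝ) ≤ A * T + B := by
  obtain ⟨c, hc⟩ : ∃ c, weilMellin φ c ≠ 0 := by
    by_contra! h
    exact hne (funext h)
  obtain ⟨b, hb0, hsupp⟩ : ∃ b : ℝ, 0 ≤ b ∧ tsupport φ ⊆ Icc (-b) b := by
    obtain ⟨b, hb⟩ := hφ.2.isCompact.isBounded.subset_closedBall 0
    refine ⟨|b|, abs_nonneg b, fun t ht ↦ ?_⟩
    have h := hb ht
    rw [mem_closedBall, dist_zero_right, Real.norm_eq_abs] at h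
    have h' : |t| ≤ |b| := h.trans (le_abs_self b)
    exact ⟨by linarith [(abs_le.1 h').1], (abs_le.1 h').2⟩
  exact ⟨Real.exp 1 * b, _, by positivity,
    fun T hT Z hZ ↦ finsetCard_zeros_le_linear hφ hb0 hsupp hc hT Z hZ⟩

/-! ## The budget on the simple critical zeros -/

/-- For a Weil test function with `φ̂ ≢ 0`: the number of simple critical zeros `1/2 + iγ`,
`0 < γ ≤ T`, of `ζ` at which `φ̂` vanishes is at most `A T + B` (`T ≥ 1`; fact-free). [folklore] -/
theorem ncard_vanishing_simpleCritical_le_linear {φ : ℝ → ℂ} (hφ : IsWeilTest φ)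
    (hne : weilMellin φ ≠ 0) :
    ∃ A B : ℝ, 0 ≤ A ∧ ∀ T : ℝ, 1 ≤ T →
      (({ρ ∈ zetaZeroBox (1 / 2) T | ρ.re = 1 / 2 ∧ riemannZetaZeroOrder ρ = 1 ∧
        weilMellin φ ρ = 0}.ncard : ℕ) : ℝ) ≤ A * T + B := by
  obtain ⟨A, B, hA, h⟩ := exists_linear_zero_budget hφ hne
  refine ⟨A, B, hA, fun T hT ↦ ?_⟩
  set S := {ρ ∈ zetaZeroBox (1 / 2) T | ρ.re = 1 / 2 ∧ riemannZetaZeroOrder ρ = 1 ∧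
    weilMellin φ ρ = 0} with hS
  have hSf : S.Finite := (zetaZeroBox_finite _ _).subset (sep_subset _ _)
  rw [ncard_eq_toFinset_card S hSf]
  refine h T hT hSf.toFinset fun u hu ↦ ?_
  rw [Finite.mem_toFinset] at hu
  obtain ⟨⟨-, -, -, him, hT'⟩, hre, -, h0⟩ := hu
  refine ⟨?_, h0⟩
  have hu1 : ‖u‖ ≤ |u.re| + |u.im| := norm_le_abs_re_add_abs_im u
  rw [hre, abs_of_pos him] at hu1
  norm_num at hu1
  linarith

/-- **Asymptotically all simple critical zeros are seen.** Under the named facts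
`riemann_von_mangoldt` (Titchmarsh Thm 9.4) and `Anderson1983_levinson_simple` (Titchmarsh §10.29
(10.29.1)), for every Weil test function with `φ̂ ≢ 0` the proportion of the simple critical zeros
`1/2 + iγ`, `0 < γ ≤ T`, at which `φ̂` vanishes tends to `0` as `T → ∞` (numerator `≤ A T + B`,
denominator `≥ N(T)/3 ≫ T log T`). [cite: Titchmarsh1986, §10.29] -/
theorem tendsto_vanishing_simpleCritical_ratio (h₁ : riemann_von_mangoldt)
    (h₂ : Anderson1983_levinson_simple) {φ : ℝ → ℂ} (hφ : IsWeilTest φ)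
    (hne : weilMellin φ ≠ 0) :
    Tendsto (fun T : ℝ ↦
      (({ρ ∈ zetaZeroBox (1 / 2) T | ρ.re = 1 / 2 ∧ riemannZetaZeroOrder ρ = 1 ∧
        weilMellin φ ρ = 0}.ncard : ℕ) : ℝ) / simpleCriticalZeroCount T) atTop (𝓝 0) := by
  obtain ⟨A, B, hA, hAB⟩ := ncard_vanishing_simpleCritical_le_linear hφ hne
  obtain ⟨T₀, hT₀⟩ := h₂.third
  rw [tendsto_order]
  refine ⟨fun a ha ↦ Eventually.of_forall fun T ↦ ha.trans_le (by positivity), fun ε hε ↦ ?_⟩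
  have hev := eventually_linear_le_zetaZeroCount_third h₁ (A / ε) ((B + 1) / ε)
  filter_upwards [hev, eventually_ge_atTop (max T₀ 1)] with T hT hT1
  have hge := hT₀ T ((le_max_left _ _).trans hT1)
  have hle := hAB T ((le_max_right _ _).trans hT1)
  -- `ε · #simple ≥ ε · N/3 ≥ A T + B + 1 > numerator`
  have h3 : A * T + (B + 1) ≤ ε * ((zetaZeroCount T : ℝ) / 3) := by
    have := mul_le_mul_of_nonneg_left hT hε.le
    rwa [mul_add, mul_div_cancel₀ _ hε.ne', ← mul_assoc, mul_div_cancel₀ _ hε.ne'] at this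
  have hpos : (0 : ℝ) < simpleCriticalZeroCount T := by
    have h1T : (1 : ℝ) ≤ T := (le_max_right _ _).trans hT1
    nlinarith
  rw [div_lt_iff₀ hpos]
  nlinarith

end Summit.RiemannHypothesis.RiemannHypothesis.Theorems.PfPersistenceM2NegIndex
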